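/-
Copyright (c) 2026 the pub-hodgecm-mathlib formalisation cell (harness21).  Prover seat hodgecm-mathlib-K2E1-p10 (g6), Track B ∕ K2-LIT, h413 =
`stmt-HodgeConjecture-24833`, route `HCCMUnconditional`; R90-TF S8 «ContSpec-n½», (M) socket road, RES-INT line 7 (7d)-prep: the letter (ONE-S) of
ED. 3 (`res_middleResidue_isPiN_of_constituent`, ★ p865082) AT ONE SPLIT PLACE from the DICTIONARY LETTERS, through ★ (7b) p865019.
-/
import Summits.HodgeConjecture.HodgeConjecture.Theorems.R90S8ResMidOneConstituentOfDictionaryU3       -- ★ (this seat) (7d)-prep non-split twin: §1 generic `exists_isConstituentOf_comap_eq_mk_equiv_quotientRep`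
import Literature.RepresentationTheory.Semisimple.Multiplicity                                       -- ★ `Representation.Equiv.ofEq`
import HarnessLib

/-!
# R90 · S8 «ContSpec-n½» — `R90S8ResMidOneConstituentSplitOfDictionaryU3`: the letter (ONE-S) of (M) :299 ED. 3 AT ONE SPLIT PLACE, from the DICTIONARY letters — an ambient smooth
# `G_v`-module `ρ_v ⊇ P` whose constituents are constituents of `P′|_{G_v}` (D1), intertwining maps `Φ_i : I(ν₀ν^{½}, χ′, ν₀ν^{−½}) → ρ_v ∘ e_w⁻¹` from the split principal series of
# `GL₃(L_w)` killing a subrepresentation `K` with irreducible quotient (D2), and «`P` meets the span of their images» (D3) [Rogawski1990 §4.13, §13.3; Zelevinsky1980 Thm. 6.1; MoeglinWaldspurger1995 IV.1.11]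

Cell `pub/hodgecm-mathlib`, crux H413 = `stmt-HodgeConjecture-24833` (lane `--kind proof --supports stmt-HodgeConjecture-24833 --as helper`), route of record
`HCCMUnconditional`; programme R90-TF, section S8, the (M) socket road, RES-INT line 7.  THEOREMS ONLY (no `def`, no `instance`, no `notation`, no `sorry`).  CLOSES NO SOCKET.

THE STEP.  ED. 3 (★ p865082 `res_middleResidue_isPiN_of_constituent`) closes (M) :299's ∃-body from `hLQ`, `hKO`, `hAF` and two letters (ONE-S), (ONE-N); ★ `oneN_at_of_dictionary`
produces (ONE-N)'s body at a non-split place from dictionary letters (D1)–(D3).  This file is the SPLIT twin: at a split `v` with the fixed witness `w = (splitWitness v hs).1` and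
`e_w = cmSplitEquiv … : U(J₃)(L⁺_v) ≃ₜ* GL₃(L_w)` (★ p864513's frame), from (D1) an ambient smooth `ρ_v ⊇ P` with constituent transfer to `P′.finRep.smoothPart ∘ inclPlace v`, (D2) a
subrepresentation `K` of the split principal series `I := parabolicIndGL (twist ![ν₀ν^{½}, χ′, ν₀ν^{−½}] ∘ det)` (★ p864766's term byte for byte) with `I ∕ K` irreducible and intertwining maps
`Φ_i : I → ρ_v ∘ e_w⁻¹` killing `K` (section dictionary ∘ `Res` at a split place; FACT-N split = ★ (b) good places ∕ one-link lattice SPLIT-LQ), (D3) `hmeet` — the body of ED. 3's `hONEs`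
at `(v, hs)`: `∃ c, (comap (localPiEquiv …) c).IsConstituentOf (P′…) ∧ ∃ π, ⟦π⟧ = c ∧ ∃ q : I → (π ∘ e_w⁻¹), q surjective`.  PROOF: §1 generic of the twin at `e := e_w⁻¹ : GL₃(L_w) ≃ₜ* U(J₃)(L⁺_v)`
gives `c`, `r : SmoothIrrep GL₃(L_w)` with `comap e_w⁻¹ c = ⟦r⟧`, `r ≅ I ∕ K`; `π := r ∘ e_w` has `⟦π⟧ = comap e_w (comap e_w⁻¹ c) = c` (★ `comap_comap_symm`) and `π ∘ e_w⁻¹ = (r ∘ e_w) ∘ e_w⁻¹ = r`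
(★ `Representation.comp_coe_comp_coe_symm`), so `q := (r = π ∘ e_w⁻¹) ∘ (I ∕ K ≅ r) ∘ (I ↠ I ∕ K)` is a surjective intertwining map.
* §1 `exists_mk_eq_surjective_of_comap_symm_eq_mk` (generic: from `comap e⁻¹ c = ⟦r⟧`, `r ≅ I ∕ K` to `⟦π⟧ = c` with a surjection `I ↠ π ∘ e⁻¹`).
* §2 **`oneS_at_of_dictionary`** — (ONE-S)'s body at `(v, hs)` in ★ p864766's bytes, from (D1)–(D3).
HONEST LABEL: HC_CM is proved only modulo the 7 printed citations (2 remaining named inputs: hLiu418 = `stmt-HodgeConjecture-24832`, h413 = `stmt-HodgeConjecture-24833`) until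
rung 0 closes; hypothesis-first on (D1)–(D3), pays no socket; count-neutral.

## References
* [Rogawski1990] J. D. Rogawski, *Automorphic Representations of Unitary Groups in Three Variables*, Ann. of Math. Stud. 123 (1990), §4.13 p. 64; §12.2 pp. 173–174; §13.3 p. 201.
* [Zelevinsky1980] A. V. Zelevinsky, *Induced representations of reductive p-adic groups II*, Ann. Sci. ÉNS 13 (1980), Thm. 6.1 (a).
* [MoeglinWaldspurger1995] C. Mœglin, J.-L. Waldspurger, *Spectral Decomposition and Eisenstein Series* (1995), IV.1.11, V.3.13.
-/

set_option autoImplicit false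
-- the mandated namespace repeats the single-problem summit's segment (`HodgeConjecture.HodgeConjecture`)
set_option linter.dupNamespace false

noncomputable section

open MeasureTheory NumberField IsDedekindDomain
open scoped Matrix MatrixGroups
open Literature.NumberTheory.GaloisRepresentations Literature.NumberTheory.Automorphic.Arthur2013.Leaves.TECR
open Literature.NumberTheory.GaloisRepresentations.IsNonarchimedeanLocalField
open Literature.NumberTheory.Automorphic Literature.NumberTheory.Automorphic.UnitaryGroup Literature.NumberTheory.Rogawski1990
open Literature.RepresentationTheory.Semisimple

namespace Summit.HodgeConjecture.HodgeConjecture.R90.S8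

/-! ## §1 Generic: `⟦r ∘ e⟧ = c` and a surjection `I ↠ (r ∘ e) ∘ e⁻¹` from `comap e⁻¹ c = ⟦r⟧`, `r ≅ I ∕ K` -/

section Generic

universe u

variable {G G' : Type u} [Group G] [TopologicalSpace G] [Group G'] [TopologicalSpace G']
  {E : Type*} [AddCommGroup E] [Module ℂ E] {I : Representation ℂ G' E}

/-- **From `comap e⁻¹ c = ⟦r⟧` and `r ≅ I ∕ K` to `⟦π⟧ = c` with a SURJECTION `I ↠ π ∘ e⁻¹`** (`e : G ≃ₜ* G′`, `π := r ∘ e`): `⟦r ∘ e⟧ = comap e (comap e⁻¹ c) = c` (★ `comap_comap_symm`), and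
`(r ∘ e) ∘ e⁻¹ = r` (★ `Representation.comp_coe_comp_coe_symm`), so `I ↠ I ∕ K ≅ r = (r ∘ e) ∘ e⁻¹` is a surjective intertwining map. [cite: Rogawski1990, §12.2 pp. 173–174] -/
theorem exists_mk_eq_surjective_of_comap_symm_eq_mk (e : G ≃ₜ* G') (K : Subrepresentation I) {c : IrrClass G} {r : SmoothIrrep G'}
    (hcr : IrrClass.comap e.symm c = IrrClass.mk r) (er : r.ρ.Equiv K.quotientRep) :
    ∃ π : SmoothIrrep G, IrrClass.mk π = c ∧ ∃ q : I.IntertwiningMap (π.comap e.symm).ρ, Function.Surjective q := by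
  refine ⟨r.comap e, ?_, ?_⟩
  · rw [← IrrClass.comap_mk, ← hcr, IrrClass.comap_comap_symm]
  · -- `((r ∘ e) ∘ e⁻¹).ρ = r.ρ`
    have hρ : ((r.comap e).comap e.symm).ρ = r.ρ := Representation.comp_coe_comp_coe_symm e r.ρ
    refine ⟨((Representation.Equiv.ofEq hρ.symm).toIntertwiningMap.comp er.symm.toIntertwiningMap).comp K.mkQ, ?_⟩
    -- the underlying function is `(r = π ∘ e⁻¹) ∘ (I ∕ K ≅ r) ∘ mkQ` (definitionally), a composite of surjections
    exact ((Representation.Equiv.ofEq hρ.symm).toLinearEquiv.surjective.comp er.symm.toLinearEquiv.surjective).comp K.mkQ_surjective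

end Generic

/-! ## §2 (ONE-S) at one split place from the dictionary letters (D1)–(D3) -/

section CM

variable (L : Type) [Field L] [NumberField L] [IsCMField L]

set_option synthInstance.maxHeartbeats 400000 in
set_option maxHeartbeats 4000000 in -- as ★ p864766 (the statement spells ★ `parabolicIndGL` + the split frame twice)
/-- **(ONE-S) AT `(v, hs)` FROM THE DICTIONARY.**  At a split place `v` of `L⁺` (witness `w = (splitWitness v hs).1`, frame `e_w = cmSplitEquiv …`): given (D1) a smooth representation `ρ_v` of
`U(J₃)(L⁺_v)` on `X : Type` and a subrepresentation `P` whose constituents are constituents of `P′.finRep.smoothPart ∘ inclPlace v` (through `IrrClass.comap (localPiEquiv …)`), (D2) a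
subrepresentation `K` of the split principal series `I(ν₀ν^{½}, χ′, ν₀ν^{−½})` of `GL₃(L_w)` (★ p864766's term) with irreducible quotient and intertwining maps `Φ_i : I → ρ_v ∘ e_w⁻¹` killing
`K`, (D3) a non-zero vector of `P` in `⨆ i, range Φ_i` — the ∃-body of ED. 3's letter `hONEs` at `(v, hs)` holds, in ★ p864766's bytes.  READING: `Φ_i = Res ∘ (section dictionary at φᵛ_i)`,
`hker` = KER ★ ∘ FACT-N (b) ∘ one-link lattice, `hmeet` = (7d) «`P′ ∩ Res(V_τ) ≠ 0`». [cite: Rogawski1990, §4.13 p. 64; §13.3 p. 201] [cite: Zelevinsky1980, Thm. 6.1 (a)] [cite: MoeglinWaldspurger1995, IV.1.11] -/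
theorem oneS_at_of_dictionary
    {μ : Measure (quasiSplit (↥(maximalRealSubfield L)) L (IsCMField.complexConj L) 3).automorphicQuotient}
    [(quasiSplit (↥(maximalRealSubfield L)) L (IsCMField.complexConj L) 3).IsAutomorphicMeasure μ]
    (μω : HeckeCharacter L) (ξ : OneDimAutRepH L) (P' : DiscreteAutomorphicRep (quasiSplit (↥(maximalRealSubfield L)) L (IsCMField.complexConj L) 3) μ)
    (v : HeightOneSpectrum (𝓞 ↥(maximalRealSubfield L))) (hs : ∃ w : PlacesOver L v, IsCMField.complexConj L • w.1 ≠ w.1)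
    -- (D1) the ambient smooth `G_v`-module and `P` inside it
    {X : Type} [AddCommGroup X] [Module ℂ X] (ρv : Representation ℂ ((quasiSplit (↥(maximalRealSubfield L)) L (IsCMField.complexConj L) 3).Local v) X)
    (hρv : ρv.IsSmooth) (P : Subrepresentation ρv)
    (hD1 : ∀ c : IrrClass ((quasiSplit (↥(maximalRealSubfield L)) L (IsCMField.complexConj L) 3).Local v), c.IsConstituentOf P.toRepresentation →
      (IrrClass.comap (localPiEquiv L (IsCMField.complexConj L) 3 ((StdForm.antidiagonal 3).over L) v) c).IsConstituentOf
        (P'.finRep.smoothPart.toRepresentation.comp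
          (inclPlace (↥(maximalRealSubfield L)) L (IsCMField.complexConj L) 3 ((StdForm.antidiagonal 3).over L) v)))
    -- (D2) the sub of the split principal series with irreducible quotient and the intertwining maps killing it
    (K : Subrepresentation (Representation.parabolicIndGL ((splitWitness v hs).1.adicCompletion L) (id : Fin 3 → Fin 3)
          ((Representation.trivial ℂ (Π a : Fin 3, GL {i : Fin 3 // (id : Fin 3 → Fin 3) i = a} ((splitWitness v hs).1.adicCompletion L)) ℂ).twist
          (∏ a : Fin 3, ((![ξ.splitν₀ μω (splitWitness v hs).1 *
          ((unramifiedTwist ((splitWitness v hs).1.adicCompletion L) (1 / 2) : QuasiChar ((splitWitness v hs).1.adicCompletion L)).toMonoidHom),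
          ξ.locψ (splitWitness v hs).1,
          ξ.splitν₀ μω (splitWitness v hs).1 *
          ((unramifiedTwist ((splitWitness v hs).1.adicCompletion L) (1 / 2) : QuasiChar ((splitWitness v hs).1.adicCompletion L)).toMonoidHom)⁻¹] :
          Fin 3 → (((splitWitness v hs).1.adicCompletion L)ˣ →* ℂˣ)) a).comp
          (Matrix.GeneralLinearGroup.det.comp (Pi.evalMonoidHom (fun a : Fin 3 => GL {i : Fin 3 // (id : Fin 3 → Fin 3) i = a} ((splitWitness v hs).1.adicCompletion L)) a))))))
    (hK : K.quotientRep.IsIrreducible) {ι : Type*}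
    (Φ : ι → (Representation.parabolicIndGL ((splitWitness v hs).1.adicCompletion L) (id : Fin 3 → Fin 3)
          ((Representation.trivial ℂ (Π a : Fin 3, GL {i : Fin 3 // (id : Fin 3 → Fin 3) i = a} ((splitWitness v hs).1.adicCompletion L)) ℂ).twist
          (∏ a : Fin 3, ((![ξ.splitν₀ μω (splitWitness v hs).1 *
          ((unramifiedTwist ((splitWitness v hs).1.adicCompletion L) (1 / 2) : QuasiChar ((splitWitness v hs).1.adicCompletion L)).toMonoidHom),
          ξ.locψ (splitWitness v hs).1,
          ξ.splitν₀ μω (splitWitness v hs).1 *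
          ((unramifiedTwist ((splitWitness v hs).1.adicCompletion L) (1 / 2) : QuasiChar ((splitWitness v hs).1.adicCompletion L)).toMonoidHom)⁻¹] :
          Fin 3 → (((splitWitness v hs).1.adicCompletion L)ˣ →* ℂˣ)) a).comp
          (Matrix.GeneralLinearGroup.det.comp (Pi.evalMonoidHom (fun a : Fin 3 => GL {i : Fin 3 // (id : Fin 3 → Fin 3) i = a} ((splitWitness v hs).1.adicCompletion L)) a))))).IntertwiningMap
        (ρv.comp ((cmSplitEquiv L ((StdForm.antidiagonal 3).over L) (UnitaryGroup.cmConj_antidiagonal_transpose L 3) ((Matrix.isUnit_iff_isUnit_det _).mp (StdForm.isUnit_over (StdForm.antidiagonal 3) L)) v (splitWitness v hs) (splitWitness_spec v hs)).symm :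
          GL (Fin 3) ((splitWitness v hs).1.adicCompletion L) →* (cmDatum L 3 ((StdForm.antidiagonal 3).over L)).Local v)))
    (hker : ∀ i, K ≤ (Φ i).ker)
    -- (D3) `P` meets the span of the images
    (hmeet : ∃ x ∈ P, x ≠ 0 ∧ x ∈ ⨆ i, LinearMap.range (Φ i).toLinearMap) :
    ∃ c : IrrClass ((quasiSplit (↥(maximalRealSubfield L)) L (IsCMField.complexConj L) 3).Local v),
      (IrrClass.comap (localPiEquiv L (IsCMField.complexConj L) 3 ((StdForm.antidiagonal 3).over L) v) c).IsConstituentOf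
          (P'.finRep.smoothPart.toRepresentation.comp
            (inclPlace (↥(maximalRealSubfield L)) L (IsCMField.complexConj L) 3 ((StdForm.antidiagonal 3).over L) v)) ∧
        ∃ (π : SmoothIrrep ((cmDatum L 3 ((StdForm.antidiagonal 3).over L)).Local v)), IrrClass.mk π = c ∧
          ∃ q : (Representation.parabolicIndGL ((splitWitness v hs).1.adicCompletion L) (id : Fin 3 → Fin 3)
          ((Representation.trivial ℂ (Π a : Fin 3, GL {i : Fin 3 // (id : Fin 3 → Fin 3) i = a} ((splitWitness v hs).1.adicCompletion L)) ℂ).twist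
          (∏ a : Fin 3, ((![ξ.splitν₀ μω (splitWitness v hs).1 *
          ((unramifiedTwist ((splitWitness v hs).1.adicCompletion L) (1 / 2) : QuasiChar ((splitWitness v hs).1.adicCompletion L)).toMonoidHom),
          ξ.locψ (splitWitness v hs).1,
          ξ.splitν₀ μω (splitWitness v hs).1 *
          ((unramifiedTwist ((splitWitness v hs).1.adicCompletion L) (1 / 2) : QuasiChar ((splitWitness v hs).1.adicCompletion L)).toMonoidHom)⁻¹] :
          Fin 3 → (((splitWitness v hs).1.adicCompletion L)ˣ →* ℂˣ)) a).comp
          (Matrix.GeneralLinearGroup.det.comp (Pi.evalMonoidHom (fun a : Fin 3 => GL {i : Fin 3 // (id : Fin 3 → Fin 3) i = a} ((splitWitness v hs).1.adicCompletion L)) a))))).IntertwiningMap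
              (π.comap (cmSplitEquiv L ((StdForm.antidiagonal 3).over L) (UnitaryGroup.cmConj_antidiagonal_transpose L 3) ((Matrix.isUnit_iff_isUnit_det _).mp (StdForm.isUnit_over (StdForm.antidiagonal 3) L)) v (splitWitness v hs) (splitWitness_spec v hs)).symm).ρ,
            Function.Surjective q := by
  obtain ⟨c, hc, r, hcr, ⟨er⟩⟩ := exists_isConstituentOf_comap_eq_mk_equiv_quotientRep
    (cmSplitEquiv L ((StdForm.antidiagonal 3).over L) (UnitaryGroup.cmConj_antidiagonal_transpose L 3) ((Matrix.isUnit_iff_isUnit_det _).mp (StdForm.isUnit_over (StdForm.antidiagonal 3) L)) v (splitWitness v hs) (splitWitness_spec v hs)).symm hρv P K hK Φ hker hmeet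
  exact ⟨c, hD1 c hc, exists_mk_eq_surjective_of_comap_symm_eq_mk
    (cmSplitEquiv L ((StdForm.antidiagonal 3).over L) (UnitaryGroup.cmConj_antidiagonal_transpose L 3) ((Matrix.isUnit_iff_isUnit_det _).mp (StdForm.isUnit_over (StdForm.antidiagonal 3) L)) v (splitWitness v hs) (splitWitness_spec v hs)) K hcr er⟩

end CM

end Summit.HodgeConjecture.HodgeConjecture.R90.S8

end
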